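import Literature.Geometry.Lorentzian.KerrConvergence
import Literature.Geometry.Lorentzian.Isometry
import HarnessLib

/-!
# Transport of causal notions and of convergence to a background along time-orientation
preserving local isometries (trunk G08 = T-LORENTZ)

Elementary bookkeeping, all **proved** (no named fact is consumed), serving the reduction
"existence of one complete globally hyperbolic development ⇒ every maximal Cauchy development
has the same asymptotics" for the stability theorems gr.S04–gr.S07 (`Stability`, `Sweep1`):

* `LorentzianMetric.val_lt_zero_of_isCausal` — the *timecone lemma*: if `T`, `T'` are timelike
  with `g(T, T') < 0` (same timecone) and `v` is causal with `g(T, v) < 0`, then `g(T', v) < 0`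
  (O'Neill 1983, Ch. 5, Lemma 5.26, Lemma 5.29 and p. 145: being in the causal future cone of a
  timelike vector does not depend on the timelike vector within its timecone). Proof by the
  segment `(1 − s) T + s v`, which consists of causal vectors, along which `g(T', ·)` is affine
  and never `0` (`val_ne_zero_of_isTimelike_of_isCausal`).
* `TimeOrientation.PreservesTimeOrientation.isFutureDirected_mfderiv` — the differential of a
  time-orientation preserving isometric immersion maps future-directed causal vectors to
  future-directed causal vectors; `IsFutureCausalCurveOn.comp_isIsometricImmersion`,
  `causalFuture_image_subset`, `causalPast_image_subset` — hence future causal curves to future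
  causal curves and `φ(J^±(S)) ⊆ J^±(φ(S))` (O'Neill 1983, Ch. 14, p. 402–403; Hawking–Ellis
  1973, §6.2).
* `Spacetime.deviation_comp`, `Spacetime.IsLateEmbedding.comp`, `Spacetime.ConvergesTo.comp` —
  for a time-orientation preserving isometric open embedding `φ : 𝓢₀ → 𝓢` which is onto, a
  late-time chart `Ψ` of `𝓢₀` gives the late-time chart `φ ∘ Ψ` of `𝓢` with the same metric
  deviation `(φ ∘ Ψ)^* g − g₀ = Ψ^* g₀' − g₀` (chain rule `pullbackBilin_comp` and
  `φ^* g = g₀'`), so `ConvergesTo B univ k` (`KerrConvergence`; DHRT arXiv:2104.08222, §1,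
  consequence form) passes from `𝓢₀` to `𝓢`; in particular `ConvergesToMinkowski univ k`.

## References

* B. O'Neill, *Semi-Riemannian geometry with applications to relativity*, Academic Press 1983,
  Ch. 3, p. 58 (pullbacks), Ch. 5, Lemma 5.26–5.29 and p. 145 (timecones), Ch. 14,
  pp. 402–403 (causal relations).
* S. W. Hawking, G. F. R. Ellis, *The large scale structure of space-time*, CUP 1973, §6.2.
* M. Dafermos, G. Holzegel, I. Rodnianski, M. Taylor, arXiv:2104.08222, §1 (consequence form of
  convergence, as vendored in `KerrConvergence`).
-/

noncomputable section

open Bundle Set Function Filter Topology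
open scoped Manifold ContDiff

namespace Literature.Geometry.Lorentzian

universe u

section Generic

variable {E : Type*} [NormedAddCommGroup E] [NormedSpace ℝ E] {H : Type*} [TopologicalSpace H]
  {I : ModelWithCorners ℝ E H} {n : ℕ∞ω} {M : Type*} [TopologicalSpace M] [ChartedSpace H M]
  [IsManifold I ∞ M]
  {E' : Type*} [NormedAddCommGroup E'] [NormedSpace ℝ E'] {H' : Type*} [TopologicalSpace H']
  {I' : ModelWithCorners ℝ E' H'} {N : Type*} [TopologicalSpace N] [ChartedSpace H' N]
  [IsManifold I' ∞ N]

namespace LorentzianMetric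

variable (g : LorentzianMetric I n M) {x : M}

/-- Along the segment from a timelike vector `T` to a causal vector `v` in the causal cone of
`T` (`g(T, v) < 0`), every vector `(1 − s) T + s v`, `0 ≤ s ≤ 1`, is causal (indeed timelike
for `s < 1`). O'Neill 1983, Ch. 5, Lemma 5.29 (convexity of timecones).
[cite: ONeillSemiRiemannian1983, Ch. 5, Lemma 5.29] -/
theorem isCausal_sub_smul_add_smul {T v : TangentSpace I x} (hT : g.IsTimelike T)
    (hv : g.IsCausal v) (hTv : g.val x T v < 0) {s : ℝ} (hs0 : 0 ≤ s) (hs1 : s ≤ 1) :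
    g.IsCausal ((1 - s) • T + s • v) := by
  rcases hs1.eq_or_lt with rfl | hs1
  · simpa using hv
  · refine IsTimelike.isCausal _ ?_
    have hvT : g.val x v T < 0 := by rwa [g.symm]
    have h1 : 0 < 1 - s := sub_pos.mpr hs1
    rw [isTimelike_iff] at hT ⊢
    have hvv : g.val x v v ≤ 0 := hv.1
    simp only [map_add, map_smul, _root_.add_apply, FunLike.coe_smul,
      Pi.smul_apply, smul_eq_mul]
    nlinarith [mul_pos h1 h1, mul_nonneg h1.le hs0, mul_nonneg hs0 hs0]

/-- **Timecone lemma.** If `T`, `T'` are timelike vectors in the same timecone (`g(T, T') < 0`)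
and `v` is a causal vector in the causal cone of `T` (`g(T, v) < 0`), then `v` is in the causal
cone of `T'` (`g(T', v) < 0`): the future causal cone is well defined by a timecone. O'Neill
1983, Ch. 5, Lemma 5.26, Lemma 5.29 and p. 145. Proof: `s ↦ g(T', (1 − s) T + s v)` is affine,
negative at `s = 0` and nowhere zero on `[0, 1]` (a causal vector is never orthogonal to a
timelike one, `val_ne_zero_of_isTimelike_of_isCausal`), hence negative at `s = 1`.
[cite: ONeillSemiRiemannian1983, Ch. 5, Lemma 5.29 and p. 145] -/
theorem val_lt_zero_of_isCausal {T T' v : TangentSpace I x} (hT : g.IsTimelike T)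
    (hT' : g.IsTimelike T') (hTT' : g.val x T T' < 0) (hv : g.IsCausal v)
    (hTv : g.val x T v < 0) : g.val x T' v < 0 := by
  by_contra h
  rcases (not_lt.mp h).eq_or_lt with h0 | hpos
  · exact g.val_ne_zero_of_isTimelike_of_isCausal hT' hv h0.symm
  · have ha : 0 < -g.val x T' T := by rw [g.symm]; linarith
    set a := -g.val x T' T with ha_def
    set b := g.val x T' v with hb_def
    have hab : 0 < a + b := by linarith
    set s := a / (a + b) with hs_def
    have hs0 : 0 ≤ s := (div_pos ha hab).le
    have hs1 : s ≤ 1 := ((div_le_one hab).mpr (by linarith))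
    have hw := g.isCausal_sub_smul_add_smul hT hv hTv hs0 hs1
    refine g.val_ne_zero_of_isTimelike_of_isCausal hT' hw ?_
    simp only [map_add, map_smul, smul_eq_mul]
    rw [show g.val x T' T = -a from by rw [ha_def, neg_neg], ← hb_def, hs_def]
    field_simp
    ring

end LorentzianMetric

namespace TimeOrientation

variable {g : LorentzianMetric I n M} (τ : TimeOrientation g) {x : M}

/-- A future-directed vector lies in the causal cone of *every* future-directed timelike vector
(not only of the orienting field). O'Neill 1983, Ch. 5, p. 145. [cite: ONeillSemiRiemannian1983, Ch. 5, p. 145] -/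
theorem IsFutureDirected.val_lt_zero {T' v : TangentSpace I x} (hT' : τ.IsFutureDirected T')
    (hT't : g.IsTimelike T') (hv : τ.IsFutureDirected v) : g.val x T' v < 0 :=
  g.val_lt_zero_of_isCausal (τ.isTimelike x) hT't hT'.2 hv.1 hv.2

/-- Conversely, a causal vector in the causal cone of some future-directed timelike vector is
future-directed. O'Neill 1983, Ch. 5, p. 145. [cite: ONeillSemiRiemannian1983, Ch. 5, p. 145] -/
theorem isFutureDirected_of_val_lt_zero {T' v : TangentSpace I x} (hT' : τ.IsFutureDirected T')
    (hT't : g.IsTimelike T') (hv : g.IsCausal v) (hT'v : g.val x T' v < 0) :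
    τ.IsFutureDirected v := by
  refine ⟨hv, g.val_lt_zero_of_isCausal hT't (τ.isTimelike x) ?_ hv hT'v⟩
  rw [g.symm]; exact hT'.2

variable {τ}
variable {gN : LorentzianMetric I' n N} {τN : TimeOrientation gN}

/-- **The differential of a time-orientation preserving isometric immersion maps
future-directed vectors to future-directed vectors.** For `φ : N → M` with `φ^* g = g_N`
(so `dφ_y` preserves scalar products and is injective) sending the orienting field of `N` into
the future cone of `M` (`PreservesTimeOrientation`), and `v ∈ T_y N` future-directed causal,
`dφ_y v` is future-directed causal. O'Neill 1983, Ch. 5, p. 145 (with the timecone lemma,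
Lemma 5.29). [cite: ONeillSemiRiemannian1983, Ch. 5, p. 145] -/
theorem PreservesTimeOrientation.isFutureDirected_mfderiv {φ : N → M}
    (hτ : τN.PreservesTimeOrientation φ τ)
    (hφ : ∀ y, pullbackBilin (I := I) (I' := I') φ g.val y = gN.val y) {y : N}
    {v : TangentSpace I' y} (hv : τN.IsFutureDirected v) :
    τ.IsFutureDirected (mfderiv I' I φ y v) := by
  have key : ∀ u w : TangentSpace I' y,
      g.val (φ y) (mfderiv I' I φ y u) (mfderiv I' I φ y w) = gN.val y u w := fun u w ↦ by
    have h := congrArg (fun b ↦ b u w) (hφ y)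
    simpa only [pullbackBilin_apply] using h
  -- `dφ T_N` is timelike and future-directed, `dφ v` is causal, in the causal cone of `dφ T_N`
  have hT : g.IsTimelike (mfderiv I' I φ y (τN.vectorField y)) := by
    rw [LorentzianMetric.isTimelike_iff, key]; exact τN.isTimelike y
  have hvc : g.IsCausal (mfderiv I' I φ y v) := by
    refine ⟨by rw [key]; exact hv.1.1, fun h0 ↦ hv.1.2 ?_⟩
    apply gN.nondegenerate y v
    intro w
    rw [← key, h0, map_zero, _root_.zero_apply]
  refine τ.isFutureDirected_of_val_lt_zero (hτ y) hT hvc ?_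
  rw [key]; exact hv.2

end TimeOrientation

namespace LorentzianMetric

variable {g : LorentzianMetric I n M} {τ : TimeOrientation g}
  {gN : LorentzianMetric I' n N} {τN : TimeOrientation gN}

/-- **Time-orientation preserving isometric immersions carry future causal curves to future
causal curves** (chain rule for the velocity, and `isFutureDirected_mfderiv`). O'Neill 1983,
Ch. 14, p. 402; Hawking–Ellis 1973, §6.2. [cite: ONeillSemiRiemannian1983, Ch. 14, p. 402] -/
theorem IsFutureCausalCurveOn.comp_mdifferentiable {φ : N → M} (hφd : MDifferentiable I' I φ)
    (hτ : τN.PreservesTimeOrientation φ τ)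
    (hφ : ∀ y, pullbackBilin (I := I) (I' := I') φ g.val y = gN.val y) {γ : ℝ → N} {s : Set ℝ}
    (hγ : gN.IsFutureCausalCurveOn τN γ s) : g.IsFutureCausalCurveOn τ (φ ∘ γ) s := by
  intro t ht
  obtain ⟨hd, hfd⟩ := hγ t ht
  refine ⟨(hφd (γ t)).comp t hd, ?_⟩
  have hvel : velocity I (φ ∘ γ) t = mfderiv I' I φ (γ t) (velocity I' γ t) := by
    unfold velocity
    rw [mfderiv_comp t (hφd (γ t)) hd]
    rfl
  rw [hvel]
  exact hτ.isFutureDirected_mfderiv hφ hfd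

/-- `φ(J⁺(S)) ⊆ J⁺(φ(S))` for a time-orientation preserving isometric immersion `φ`. O'Neill
1983, Ch. 14, pp. 402–403. [cite: ONeillSemiRiemannian1983, Ch. 14, pp. 402–403] -/
theorem image_causalFuture_subset {φ : N → M} (hφd : MDifferentiable I' I φ)
    (hτ : τN.PreservesTimeOrientation φ τ)
    (hφ : ∀ y, pullbackBilin (I := I) (I' := I') φ g.val y = gN.val y) (S : Set N) :
    φ '' gN.causalFuture τN S ⊆ g.causalFuture τ (φ '' S) := by
  rintro _ ⟨q, hq, rfl⟩
  rcases hq with hq | ⟨p, hp, γ, a, b, hab, hγ, hγa, hγb⟩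
  · exact Or.inl (mem_image_of_mem φ hq)
  · refine Or.inr ⟨φ p, mem_image_of_mem φ hp, φ ∘ γ, a, b, hab,
      hγ.comp_mdifferentiable hφd hτ hφ, ?_, ?_⟩
    · simp [hγa]
    · simp [hγb]

/-- Time-orientation preservation is symmetric under simultaneous reversal of both time
orientations (`dφ(−T_N) = −dφ(T_N)` is past-directed for `τ`, i.e. future-directed for
`τ.reverse`). O'Neill 1983, Ch. 5, p. 145. [cite: ONeillSemiRiemannian1983, Ch. 5, p. 145] -/
theorem _root_.Literature.Geometry.Lorentzian.TimeOrientation.PreservesTimeOrientation.reverse {φ : N → M}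
    (hτ : τN.PreservesTimeOrientation φ τ) :
    τN.reverse.PreservesTimeOrientation φ τ.reverse := by
  intro y
  rw [TimeOrientation.vectorField_reverse, map_neg, TimeOrientation.isFutureDirected_reverse_iff,
    ← TimeOrientation.isFutureDirected_neg_iff, neg_neg]
  exact hτ y

/-- `φ(J⁻(S)) ⊆ J⁻(φ(S))` for a time-orientation preserving isometric immersion `φ` (time dual
of `image_causalFuture_subset`). O'Neill 1983, Ch. 14, p. 403. [cite: ONeillSemiRiemannian1983, Ch. 14, p. 403] -/
theorem image_causalPast_subset {φ : N → M} (hφd : MDifferentiable I' I φ)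
    (hτ : τN.PreservesTimeOrientation φ τ)
    (hφ : ∀ y, pullbackBilin (I := I) (I' := I') φ g.val y = gN.val y) (S : Set N) :
    φ '' gN.causalPast τN S ⊆ g.causalPast τ (φ '' S) :=
  image_causalFuture_subset hφd hτ.reverse hφ S

end LorentzianMetric

end Generic

/-! ### Late-time charts and convergence under surjective isometric embeddings -/

namespace Spacetime

variable {𝓢₀ 𝓢 : Spacetime.{u} 4} (B : ModelBackground)

/-- **The metric deviation is invariant under composition with an isometric immersion**:
`(φ ∘ Ψ)^* g − g₀ = Ψ^* g₀' − g₀` when `φ^* g = g₀'` (chain rule for pullbacks,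
`pullbackBilin_comp`). O'Neill 1983, Ch. 3, p. 58; DHRT arXiv:2104.08222, §1 (the deviation).
[cite: ONeillSemiRiemannian1983, Ch. 3, p. 58] -/
theorem deviation_comp {φ : 𝓢₀.carrier → 𝓢.carrier} (hφd : MDifferentiable (𝓡 4) (𝓡 4) φ)
    (hφ : ∀ y, pullbackBilin (I := 𝓡 4) (I' := 𝓡 4) φ 𝓢.metric.val y = 𝓢₀.metric.val y)
    {Ψ : B.domain → 𝓢₀.carrier} (hΨ : MDifferentiable 𝓘(ℝ, E4) (𝓡 4) Ψ) :
    𝓢.deviation B (φ ∘ Ψ) = 𝓢₀.deviation B Ψ := by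
  funext x
  unfold deviation
  congr 1
  change pullbackBilin (I := 𝓡 4) (I' := 𝓘(ℝ, E4)) (φ ∘ Ψ) 𝓢.metric.val x =
    pullbackBilin (I := 𝓡 4) (I' := 𝓘(ℝ, E4)) Ψ 𝓢₀.metric.val x
  rw [pullbackBilin_comp hφd hΨ, show pullbackBilin (I := 𝓡 4) (I' := 𝓡 4) φ 𝓢.metric.val =
    𝓢₀.metric.val from funext hφ]

/-- **Late-time embeddings push forward along surjective isometric open embeddings.** If `Ψ`
is a late-time embedding of the background `B` into all of `𝓢₀` after time `τ₀` and
`φ : 𝓢₀ → 𝓢` is a smooth, time-orientation preserving, isometric open embedding onto `𝓢`, then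
`φ ∘ Ψ` is a late-time embedding into all of `𝓢`: smoothness and openness compose, and the
covering condition `M ∖ Ψ({t > τ₀}) ⊆ J⁻(Ψ({t = τ₀}))` is transported by
`image_causalPast_subset` and surjectivity. DHRT arXiv:2104.08222, §1 (consequence form, as
vendored in `KerrConvergence`). [cite: arXiv210408222, §1] -/
theorem IsLateEmbedding.comp_of_surjective {τ₀ : ℝ} {Ψ : B.domain → 𝓢₀.carrier}
    (hΨ : 𝓢₀.IsLateEmbedding B univ τ₀ Ψ) {φ : 𝓢₀.carrier → 𝓢.carrier}
    (hφs : ContMDiff (𝓡 4) (𝓡 4) ∞ φ) (hopen : IsOpenEmbedding φ)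
    (hφ : ∀ y, pullbackBilin (I := 𝓡 4) (I' := 𝓡 4) φ 𝓢.metric.val y = 𝓢₀.metric.val y)
    (hτ : 𝓢₀.timeOrientation.PreservesTimeOrientation φ 𝓢.timeOrientation)
    (hsurj : Surjective φ) : 𝓢.IsLateEmbedding B univ τ₀ (φ ∘ Ψ) where
  contMDiff := hφs.comp hΨ.contMDiff
  isOpenEmbedding := hopen.comp hΨ.isOpenEmbedding
  image_subset := subset_univ _
  diff_subset_causalPast := by
    rintro x ⟨-, hx⟩
    obtain ⟨x₀, rfl⟩ := hsurj x
    have hx₀ : x₀ ∉ Ψ '' B.lateRegion τ₀ := fun ⟨z, hz, hzx⟩ ↦ hx ⟨z, hz, by simp [← hzx]⟩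
    have h := hΨ.diff_subset_causalPast ⟨mem_univ _, hx₀⟩
    have h' := LorentzianMetric.image_causalPast_subset (hφs.mdifferentiable (by simp)) hτ hφ
      (Ψ '' B.timeSlab τ₀) (mem_image_of_mem φ h)
    rwa [image_image] at h'

/-- **Convergence to a background pushes forward along surjective isometric open embeddings**:
if `𝓢₀` converges to `B` in `Cᵏ` on all of `𝓢₀` and `φ : 𝓢₀ → 𝓢` is a smooth,
time-orientation preserving, isometric open embedding onto `𝓢`, then `𝓢` converges to `B` in
`Cᵏ` on all of `𝓢`, in the chart `φ ∘ Ψ`, with the *same* deviation function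
(`deviation_comp`). DHRT arXiv:2104.08222, §1 (consequence form, `KerrConvergence`).
[cite: arXiv210408222, §1] -/
theorem ConvergesTo.comp_of_surjective {k : ℕ} (h : 𝓢₀.ConvergesTo B univ k)
    {φ : 𝓢₀.carrier → 𝓢.carrier} (hφs : ContMDiff (𝓡 4) (𝓡 4) ∞ φ) (hopen : IsOpenEmbedding φ)
    (hφ : ∀ y, pullbackBilin (I := 𝓡 4) (I' := 𝓡 4) φ 𝓢.metric.val y = 𝓢₀.metric.val y)
    (hτ : 𝓢₀.timeOrientation.PreservesTimeOrientation φ 𝓢.timeOrientation)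
    (hsurj : Surjective φ) : 𝓢.ConvergesTo B univ k := by
  obtain ⟨τ₀, Ψ, hΨ, ht⟩ := h
  refine ⟨τ₀, φ ∘ Ψ, hΨ.comp_of_surjective B hφs hopen hφ hτ hsurj, ?_⟩
  have hdev : 𝓢.deviationCk B (φ ∘ Ψ) k = 𝓢₀.deviationCk B Ψ k := by
    funext τ
    unfold deviationCk deviationExtend
    rw [deviation_comp B (hφs.mdifferentiable (by simp)) hφ
      (hΨ.contMDiff.mdifferentiable (by simp))]
  rw [hdev]
  exact ht

/-- **Convergence to Minkowski space pushes forward along surjective isometric open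
embeddings** (`ConvergesTo.comp_of_surjective` for `Minkowski.background`): the form in which
the conclusion of Lindblad–Rodnianski, Ann. of Math. 171 (2010), Thm. 1.1 /
Christodoulou–Klainerman 1993, Thm. 1.0.2 is transported from one development to an isometric
one. [cite: arXiv210408222, §1] -/
theorem ConvergesToMinkowski.comp_of_surjective {k : ℕ} (h : 𝓢₀.ConvergesToMinkowski univ k)
    {φ : 𝓢₀.carrier → 𝓢.carrier} (hφs : ContMDiff (𝓡 4) (𝓡 4) ∞ φ) (hopen : IsOpenEmbedding φ)
    (hφ : ∀ y, pullbackBilin (I := 𝓡 4) (I' := 𝓡 4) φ 𝓢.metric.val y = 𝓢₀.metric.val y)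
    (hτ : 𝓢₀.timeOrientation.PreservesTimeOrientation φ 𝓢.timeOrientation)
    (hsurj : Surjective φ) : 𝓢.ConvergesToMinkowski univ k :=
  ConvergesTo.comp_of_surjective _ h hφs hopen hφ hτ hsurj

end Spacetime

end Literature.Geometry.Lorentzian

end
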